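import Mathlib.Analysis.InnerProductSpace.Basic
import HarnessLib

/-!
# Venture YMGap, track Y3 FLOW-DATA — second-order tail («x2r») certificate of lineage C, file 1/2: block lemmas

HONEST FRAMING: venture file of the cell `pub-ymgap` (QuantumFields programme), track Y3; companion of
`FlowData/SecondOrderTailCertificate.lean` (file 2/2, which carries the full story and the assembled inequality).  Lineage C
(engine-3, kernels «sce-onesite2x» / «x2r»; method note `engine/sce/results-Y3/onesite2/code-x2r/X2R-METHOD.md`, accepted by
the cell's flow referee as FR-156, 2026-08-23) bounds the TOP eigenvalue of a positive semidefinite symmetric block `T` from a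
KEPT set of coordinates (projection `1 − Q`, the dropped block `Q T Q ⪯ ε`).  This file holds the three self-contained
linear-algebra steps, on a real inner product space `E` with `T`, `Q`, `A`, `C` linear maps given through their symmetry /
idempotency / positivity as hypotheses (no spectral theorem, no finite-dimensionality):

* §0 bookkeeping for a symmetric idempotent `Q` (`⟨Q x, x⟩ = ‖Q x‖²`, Pythagoras);
* §1 `schur_tail`, `le_of_schur_tail` — the SCHUR-COMPLEMENT step: if `T x = λ x`, `x ≠ 0`, `ε < λ`, then
  `a = x − Q x ≠ 0` and `λ ‖a‖² ≤ ⟨a, T a⟩ + ‖Q (T a)‖²/(λ − ε)`; hence `λ ≤ U` for every bound `U` of the augmented kept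
  form `⟨a, T a⟩ + ‖Q (T a)‖²/(ℓ − ε)` on `ker Q` (`ε < ℓ ≤ λ`) — `λ_max(T) ≤ λ_max(T_SS + T_S⊥ T_⊥S/(ℓ − ε))`;
* §2 `form_cauchy_schwarz`, `offblock_sq_le` — for `T ⪰ 0`: `‖Q (T a)‖² ≤ ε ⟨a, T a⟩`;
* §3 `compression_bound` — the 2 × 2 compression along a unit eigenvector `u₀` of a symmetric `A` (`A u₀ = μ₀ u₀`,
  `A ⪯ μ₁` on `u₀^⊥`) for a correction `0 ⪯ C ⪯ γ`, `c = ⟨u₀, C u₀⟩`: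
  `⟨a, (A + C) a⟩ ≤ (μ₀ + c + cγ/(μ₀ + c − μ₁ − γ)) ‖a‖²` when `μ₀ + c − μ₁ − γ > 0`.

No matrix, no number, no row, nothing about limits or a mass gap.  References: R. A. Horn, C. R. Johnson, *Matrix Analysis*,
2nd ed. (2013), Thm 7.7.7 / (0.8.5) (Schur complement) [cite: HornJohnson2013, Thm 7.7.7]; the cell's X2R-METHOD.md §«The
bounds» and FLOW-REFEREE.md FR-156 (2026-08-23).
-/

noncomputable section

open scoped InnerProductSpace
open RealInnerProductSpace

namespace Summit.Ventures.YMGap.FlowData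

namespace SecondOrderTail

variable {E : Type*} [NormedAddCommGroup E] [InnerProductSpace ℝ E]

/-! ### §0 Symmetric idempotents (the coordinate projection onto the dropped states) -/

section Proj

variable {Q : E →ₗ[ℝ] E} (hQs : ∀ x y : E, ⟪Q x, y⟫ = ⟪x, Q y⟫) (hQi : ∀ x : E, Q (Q x) = Q x)
include hQs hQi

/-- For a symmetric idempotent `Q`: `⟨Q x, y⟩ = ⟨Q x, Q y⟩`. [folklore] -/
theorem inner_proj_left_eq (x y : E) : ⟪Q x, y⟫ = ⟪Q x, Q y⟫ := by
  rw [← hQi x, hQs (Q x) y, hQi x]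

/-- For a symmetric idempotent `Q`: `⟨Q x, x⟩ = ‖Q x‖²`. [folklore] -/
theorem inner_proj_self (x : E) : ⟪Q x, x⟫ = ‖Q x‖ ^ 2 := by
  rw [inner_proj_left_eq hQs hQi x x, real_inner_self_eq_norm_sq]

/-- For a symmetric idempotent `Q`: `⟨x − Q x, Q y⟩ = 0`. [folklore] -/
theorem inner_sub_proj_proj (x y : E) : ⟪x - Q x, Q y⟫ = 0 := by
  rw [inner_sub_left, ← hQs x y, inner_proj_left_eq hQs hQi x y, sub_self]

/-- Pythagoras for a symmetric idempotent: `‖x‖² = ‖x − Q x‖² + ‖Q x‖²`. [folklore] -/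
theorem norm_sq_eq_ker_add_proj (x : E) : ‖x‖ ^ 2 = ‖x - Q x‖ ^ 2 + ‖Q x‖ ^ 2 := by
  have h0 : ⟪x - Q x, Q x⟫ = 0 := inner_sub_proj_proj hQs hQi x x
  have e : ⟪x, x⟫ = ⟪x - Q x, x - Q x⟫ + 2 * ⟪x - Q x, Q x⟫ + ⟪Q x, Q x⟫ := by
    have hx : x = (x - Q x) + Q x := by abel
    conv_lhs => rw [hx]
    rw [inner_add_left, inner_add_right, inner_add_right, real_inner_comm (x - Q x) (Q x)]
    ring
  rw [h0, real_inner_self_eq_norm_sq, real_inner_self_eq_norm_sq, real_inner_self_eq_norm_sq] at e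
  linarith

/-- `‖Q x‖ ≤ ‖x‖` and `‖x − Q x‖ ≤ ‖x‖` for a symmetric idempotent. [folklore] -/
theorem norm_ker_sq_le (x : E) : ‖x - Q x‖ ^ 2 ≤ ‖x‖ ^ 2 := by
  have := norm_sq_eq_ker_add_proj hQs hQi x
  nlinarith [sq_nonneg ‖Q x‖]

end Proj

/-! ### §1 The Schur-complement step (second-order kinetic tail) -/

section Schur

variable {T Q : E →ₗ[ℝ] E} (hTs : ∀ x y : E, ⟪T x, y⟫ = ⟪x, T y⟫)
  (hQs : ∀ x y : E, ⟪Q x, y⟫ = ⟪x, Q y⟫) (hQi : ∀ x : E, Q (Q x) = Q x)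
include hTs hQs hQi

/-- **Schur-complement tail step.**  `T` symmetric, `Q` a symmetric idempotent (projection onto the DROPPED coordinates)
with `⟨Q y, T Q y⟩ ≤ ε ‖Q y‖²` (the dropped diagonal block is `⪯ ε`).  If `T x = λ x` with `x ≠ 0` and `ε < λ`, then the
kept component `a = x − Q x` is non-zero and `λ ‖a‖² ≤ ⟨a, T a⟩ + ‖Q (T a)‖² / (λ − ε)` — i.e. `λ` is at most the top of
the kept block augmented by the Schur complement `B (λ − ε)⁻¹ Bᵀ ⪰ B (λ − D)⁻¹ Bᵀ`.  (From `(λ − D) b = Bᵀ a` for the dropped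
component `b = Q x`: `(λ − ε)‖b‖² ≤ ⟨b, T a⟩ ≤ ‖b‖ ‖Q T a‖`.) [cite: HornJohnson2013, Thm 7.7.7] -/
theorem schur_tail {ε lam : ℝ} (hD : ∀ y : E, ⟪Q y, T (Q y)⟫ ≤ ε * ‖Q y‖ ^ 2) {x : E}
    (hx : T x = lam • x) (hx0 : x ≠ 0) (hε : ε < lam) :
    x - Q x ≠ 0 ∧
      lam * ‖x - Q x‖ ^ 2 ≤ ⟪x - Q x, T (x - Q x)⟫ + ‖Q (T (x - Q x))‖ ^ 2 / (lam - ε) := by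
  set a := x - Q x with ha
  have hxab : x = a + Q x := by rw [ha]; abel
  have hd : 0 < lam - ε := sub_pos.mpr hε
  -- the dropped component b = Q x
  have h1 : ⟪Q x, T x⟫ = lam * ‖Q x‖ ^ 2 := by
    rw [hx, real_inner_smul_right, inner_proj_self hQs hQi x]
  have hTx : T x = T a + T (Q x) := by rw [← map_add, ← hxab]
  have h2 : ⟪Q x, T x⟫ = ⟪Q x, T a⟫ + ⟪Q x, T (Q x)⟫ := by
    rw [hTx, inner_add_right]
  have h3 : ⟪Q x, T (Q x)⟫ ≤ ε * ‖Q x‖ ^ 2 := hD x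
  have h4 : ⟪Q x, T a⟫ ≤ ‖Q x‖ * ‖Q (T a)‖ := by
    rw [inner_proj_left_eq hQs hQi x (T a)]
    exact real_inner_le_norm _ _
  have E1 : (lam - ε) * ‖Q x‖ ^ 2 ≤ ⟪Q x, T a⟫ := by nlinarith [h1, h2, h3]
  have E3 : ‖Q x‖ * ‖Q (T a)‖ ≤ ‖Q (T a)‖ ^ 2 / (lam - ε) := by
    rw [le_div_iff₀ hd]
    have hβ : 0 ≤ ‖Q x‖ := norm_nonneg _
    have hg : 0 ≤ ‖Q (T a)‖ := norm_nonneg _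
    rcases hβ.eq_or_lt with hβ0 | hβpos
    · rw [← hβ0]; nlinarith
    · have hle : (lam - ε) * ‖Q x‖ ≤ ‖Q (T a)‖ := by
        by_contra hcon
        have hcon' := lt_of_not_ge hcon
        nlinarith [E1, h4]
      nlinarith [hle]
  have h5 : ⟪Q x, T a⟫ ≤ ‖Q (T a)‖ ^ 2 / (lam - ε) := h4.trans E3
  -- the kept component a
  have hab : ⟪a, Q x⟫ = 0 := inner_sub_proj_proj hQs hQi x x
  have h6 : ⟪a, T x⟫ = lam * ‖a‖ ^ 2 := by
    rw [hx, real_inner_smul_right]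
    conv_lhs => rw [hxab]
    rw [inner_add_right, hab, add_zero, real_inner_self_eq_norm_sq]
  have h7 : ⟪a, T x⟫ = ⟪a, T a⟫ + ⟪Q x, T a⟫ := by
    rw [hTx, inner_add_right, ← hTs a (Q x), real_inner_comm (Q x) (T a)]
  refine ⟨?_, by linarith [h5, h6, h7]⟩
  intro h0
  have hTa : T a = 0 := by rw [h0, map_zero]
  have hg0 : ⟪Q x, T a⟫ = 0 := by rw [hTa, inner_zero_right]
  have hβ0 : ‖Q x‖ ^ 2 = 0 := by nlinarith [E1, hg0, sq_nonneg ‖Q x‖]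
  have hb0 : Q x = 0 := by
    have : ‖Q x‖ = 0 := pow_eq_zero_iff (n := 2) (by norm_num) |>.mp hβ0
    exact norm_eq_zero.mp this
  apply hx0
  rw [hxab, h0, hb0, add_zero]

/-- **The Schur tail bound in usable form.**  Under the hypotheses of `schur_tail`, if `ε < ℓ ≤ λ` and `U` bounds the
augmented kept form, `⟨a, T a⟩ + ‖Q (T a)‖²/(ℓ − ε) ≤ U ‖a‖²` for every `a` with `Q a = 0`, then `λ ≤ U`:
`λ_max(T) ≤ λ_max(T_SS + T_S⊥ T_⊥S /(ℓ − ε))`. [cite: HornJohnson2013, Thm 7.7.7] -/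
theorem le_of_schur_tail {ε ℓ lam U : ℝ} (hD : ∀ y : E, ⟪Q y, T (Q y)⟫ ≤ ε * ‖Q y‖ ^ 2) {x : E}
    (hx : T x = lam • x) (hx0 : x ≠ 0) (hεℓ : ε < ℓ) (hℓ : ℓ ≤ lam)
    (hU : ∀ a : E, Q a = 0 → ⟪a, T a⟫ + ‖Q (T a)‖ ^ 2 / (ℓ - ε) ≤ U * ‖a‖ ^ 2) : lam ≤ U := by
  obtain ⟨ha0, hmain⟩ := schur_tail hTs hQs hQi hD hx hx0 (hεℓ.trans_le hℓ)
  have hQa : Q (x - Q x) = 0 := by rw [map_sub, hQi, sub_self]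
  have hUa := hU (x - Q x) hQa
  have hpos : 0 < ‖x - Q x‖ ^ 2 := by positivity
  have hmono : ‖Q (T (x - Q x))‖ ^ 2 / (lam - ε) ≤ ‖Q (T (x - Q x))‖ ^ 2 / (ℓ - ε) :=
    div_le_div_of_nonneg_left (sq_nonneg _) (sub_pos.mpr hεℓ) (by linarith)
  by_contra hcon
  have hcon' := lt_of_not_ge hcon
  nlinarith [hmain, hUa, hmono, hcon', hpos]

end Schur

/-! ### §2 Positive semidefinite forms: Cauchy–Schwarz and the off-block bound `‖Q T a‖² ≤ ε ⟨a, T a⟩` -/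

section PSD

variable {T : E →ₗ[ℝ] E} (hTs : ∀ x y : E, ⟪T x, y⟫ = ⟪x, T y⟫) (hpos : ∀ z : E, 0 ≤ ⟪z, T z⟫)
include hTs hpos

/-- Cauchy–Schwarz for the positive semidefinite symmetric form `⟨·, T ·⟩`: `⟨u, T v⟩² ≤ ⟨u, T u⟩ ⟨v, T v⟩`. [folklore] -/
theorem form_cauchy_schwarz (u v : E) : ⟪u, T v⟫ ^ 2 ≤ ⟪u, T u⟫ * ⟪v, T v⟫ := by
  have hvu : ⟪v, T u⟫ = ⟪u, T v⟫ := by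
    rw [← hTs v u]
    exact real_inner_comm u (T v)
  have h : ∀ t : ℝ, 0 ≤ ⟪v, T v⟫ * (t * t) + (-(2 * ⟪u, T v⟫)) * t + ⟪u, T u⟫ := by
    intro t
    have h0 := hpos (u - t • v)
    have e : ⟪u - t • v, T (u - t • v)⟫ = ⟪v, T v⟫ * (t * t) + (-(2 * ⟪u, T v⟫)) * t + ⟪u, T u⟫ := by
      rw [map_sub, map_smul, inner_sub_left, inner_sub_right, inner_sub_right, real_inner_smul_left,
        real_inner_smul_left, real_inner_smul_right, real_inner_smul_right, hvu]
      ring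
    rw [e] at h0
    exact h0
  have hd := discrim_le_zero h
  rw [discrim] at hd
  nlinarith [hd]

variable {Q : E →ₗ[ℝ] E} (hQs : ∀ x y : E, ⟪Q x, y⟫ = ⟪x, Q y⟫) (hQi : ∀ x : E, Q (Q x) = Q x)
include hQs hQi

/-- **Off-block bound.**  For `T ⪰ 0` symmetric and a symmetric idempotent `Q` with `⟨Q y, T Q y⟩ ≤ ε ‖Q y‖²` (`ε ≥ 0`):
`‖Q (T a)‖² ≤ ε ⟨a, T a⟩` for every `a` — the block Cauchy–Schwarz inequality `‖T_⊥S a‖² ≤ ‖T_⊥⊥‖ ⟨a, T a⟩`. [folklore] -/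
theorem offblock_sq_le {ε : ℝ} (hε : 0 ≤ ε) (hD : ∀ y : E, ⟪Q y, T (Q y)⟫ ≤ ε * ‖Q y‖ ^ 2) (a : E) :
    ‖Q (T a)‖ ^ 2 ≤ ε * ⟪a, T a⟫ := by
  set w := Q (T a) with hw
  have e1 : ‖w‖ ^ 2 = ⟪w, T a⟫ := by
    rw [hw, inner_proj_left_eq hQs hQi (T a) (T a), real_inner_self_eq_norm_sq]
  have cs : ⟪w, T a⟫ ^ 2 ≤ ⟪w, T w⟫ * ⟪a, T a⟫ := form_cauchy_schwarz hTs hpos w a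
  have hDw : ⟪w, T w⟫ ≤ ε * ‖w‖ ^ 2 := hD (T a)
  have haT : 0 ≤ ⟪a, T a⟫ := hpos a
  have key : ‖w‖ ^ 2 * ‖w‖ ^ 2 ≤ ‖w‖ ^ 2 * (ε * ⟪a, T a⟫) := by
    calc ‖w‖ ^ 2 * ‖w‖ ^ 2 = ⟪w, T a⟫ ^ 2 := by rw [e1]; ring
      _ ≤ ⟪w, T w⟫ * ⟪a, T a⟫ := cs
      _ ≤ (ε * ‖w‖ ^ 2) * ⟪a, T a⟫ := mul_le_mul_of_nonneg_right hDw haT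
      _ = ‖w‖ ^ 2 * (ε * ⟪a, T a⟫) := by ring
  rcases (sq_nonneg ‖w‖).eq_or_lt with h0 | hp
  · rw [← h0]; exact mul_nonneg hε haT
  · exact le_of_mul_le_mul_left key hp

end PSD

/-! ### §3 The 2 × 2 compression along the top eigenvector of the kept block -/

section Unit

/-- Decomposition along a unit vector: with `α = ⟨u₀, a⟩`, `y = a − α u₀` one has `⟨u₀, y⟩ = 0` and
`‖a‖² = α² + ‖y‖²`. [folklore] -/
theorem norm_sq_eq_along_unit {u₀ : E} (hu : ‖u₀‖ = 1) (a : E) :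
    ⟪u₀, a - ⟪u₀, a⟫ • u₀⟫ = 0 ∧ ‖a‖ ^ 2 = ⟪u₀, a⟫ ^ 2 + ‖a - ⟪u₀, a⟫ • u₀‖ ^ 2 := by
  have huu : ⟪u₀, u₀⟫ = 1 := by rw [real_inner_self_eq_norm_sq, hu, one_pow]
  have h1 : ⟪u₀, a - ⟪u₀, a⟫ • u₀⟫ = 0 := by
    rw [inner_sub_right, real_inner_smul_right, huu, mul_one, sub_self]
  refine ⟨h1, ?_⟩
  have e : a = ⟪u₀, a⟫ • u₀ + (a - ⟪u₀, a⟫ • u₀) := by abel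
  conv_lhs => rw [e]
  rw [norm_add_sq_real, real_inner_smul_left, h1, mul_zero, mul_zero, add_zero, norm_smul, hu, mul_one,
    Real.norm_eq_abs, sq_abs]

end Unit

section Compression

variable {A C : E →ₗ[ℝ] E} (hAs : ∀ x y : E, ⟪A x, y⟫ = ⟪x, A y⟫) (hCs : ∀ x y : E, ⟪C x, y⟫ = ⟪x, C y⟫)
  (hCpos : ∀ z : E, 0 ≤ ⟪z, C z⟫)
include hAs hCs hCpos

set_option maxHeartbeats 400000 in
/-- **2 × 2 compression bound.**  `A` symmetric with a unit eigenvector `u₀`, `A u₀ = μ₀ u₀`, and `⟨y, A y⟩ ≤ μ₁ ‖y‖²` on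
`u₀^⊥`; `C ⪰ 0` symmetric with `⟨z, C z⟩ ≤ γ ‖z‖²`, `γ ≥ 0`, `c := ⟨u₀, C u₀⟩`.  If `δ := μ₀ + c − μ₁ − γ > 0` then for every `a`
`⟨a, (A + C) a⟩ ≤ (μ₀ + c + cγ/δ) ‖a‖²`, i.e. `λ_max(A + C) ≤ λ_max [[μ₀ + c, √(cγ)], [√(cγ), μ₁ + γ]] ≤ μ₀ + c + cγ/δ`
(write `a = α u₀ + y`; the coupling `2α⟨u₀, C y⟩` is at most `2|α| √c √(γ) ‖y‖` by Cauchy–Schwarz for `C`). [folklore] -/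
theorem compression_bound {u₀ : E} (hu : ‖u₀‖ = 1) {μ₀ μ₁ γ : ℝ} (hAu : A u₀ = μ₀ • u₀)
    (hμ₁ : ∀ y : E, ⟪u₀, y⟫ = 0 → ⟪y, A y⟫ ≤ μ₁ * ‖y‖ ^ 2) (hγ : 0 ≤ γ)
    (hCγ : ∀ z : E, ⟪z, C z⟫ ≤ γ * ‖z‖ ^ 2) (hδ : 0 < μ₀ + ⟪u₀, C u₀⟫ - μ₁ - γ) (a : E) :
    ⟪a, A a⟫ + ⟪a, C a⟫ ≤
      (μ₀ + ⟪u₀, C u₀⟫ + ⟪u₀, C u₀⟫ * γ / (μ₀ + ⟪u₀, C u₀⟫ - μ₁ - γ)) * ‖a‖ ^ 2 := by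
  obtain ⟨hy, hnorm⟩ := norm_sq_eq_along_unit hu a
  set α := ⟪u₀, a⟫ with hα
  set y := a - α • u₀ with hydef
  set c := ⟪u₀, C u₀⟫ with hc
  set δ := μ₀ + c - μ₁ - γ with hδdef
  have huu : ⟪u₀, u₀⟫ = 1 := by rw [real_inner_self_eq_norm_sq, hu, one_pow]
  have e : a = α • u₀ + y := by rw [hydef]; abel
  have hyu : ⟪y, u₀⟫ = 0 := by rw [real_inner_comm]; exact hy
  -- the A-part
  have hAy0 : ⟪u₀, A y⟫ = 0 := by rw [← hAs, hAu, real_inner_smul_left, hy, mul_zero]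
  have hA : ⟪a, A a⟫ = α ^ 2 * μ₀ + ⟪y, A y⟫ := by
    rw [e, map_add, map_smul, hAu, inner_add_left, inner_add_right, inner_add_right, real_inner_smul_left,
      real_inner_smul_left, real_inner_smul_right, real_inner_smul_right, huu, hAy0, smul_smul, real_inner_smul_right,
      hyu]
    ring
  have hAy : ⟪y, A y⟫ ≤ μ₁ * ‖y‖ ^ 2 := hμ₁ y hy
  -- the C-part
  have hCyu : ⟪y, C u₀⟫ = ⟪u₀, C y⟫ := by rw [← hCs y u₀]; exact real_inner_comm u₀ (C y)
  have hC : ⟪a, C a⟫ = α ^ 2 * c + 2 * α * ⟪u₀, C y⟫ + ⟪y, C y⟫ := by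
    rw [e, map_add, map_smul, inner_add_left, inner_add_right, inner_add_right, real_inner_smul_left,
      real_inner_smul_left, real_inner_smul_right, real_inner_smul_right, hCyu, hc]
    ring
  have cs : ⟪u₀, C y⟫ ^ 2 ≤ c * ⟪y, C y⟫ := form_cauchy_schwarz hCs hCpos u₀ y
  have hp0 : 0 ≤ ⟪y, C y⟫ := hCpos y
  have hpγ : ⟪y, C y⟫ ≤ γ * ‖y‖ ^ 2 := hCγ y
  have hc0 : 0 ≤ c := hCpos u₀
  have hq2 : ⟪u₀, C y⟫ ^ 2 ≤ c * γ * ‖y‖ ^ 2 := by nlinarith [cs, hpγ, hc0]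
  -- the mixed term: c γ α² − 2 δ α q + δ² ‖y‖² ≥ 0
  have hT0 : 0 ≤ c * γ * α ^ 2 - 2 * δ * α * ⟪u₀, C y⟫ + δ ^ 2 * ‖y‖ ^ 2 := by
    rcases (mul_nonneg hc0 hγ).eq_or_lt with h0 | hcγ
    · have hq0 : ⟪u₀, C y⟫ = 0 := by
        have : ⟪u₀, C y⟫ ^ 2 ≤ 0 := by rw [← h0] at hq2; simpa using hq2
        exact pow_eq_zero_iff (n := 2) (by norm_num) |>.mp (le_antisymm this (sq_nonneg _))
      rw [hq0]
      nlinarith [mul_nonneg (mul_nonneg hc0 hγ) (sq_nonneg α), sq_nonneg (δ * ‖y‖)]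
    · have key : (c * γ) * 0 ≤ (c * γ) * (c * γ * α ^ 2 - 2 * δ * α * ⟪u₀, C y⟫ + δ ^ 2 * ‖y‖ ^ 2) := by
        nlinarith [sq_nonneg (c * γ * α - δ * ⟪u₀, C y⟫), hq2, sq_nonneg δ]
      exact le_of_mul_le_mul_left key hcγ
  -- assemble (clear the denominator δ > 0)
  have key : δ * (⟪a, A a⟫ + ⟪a, C a⟫) ≤ (δ * (μ₀ + c) + c * γ) * ‖a‖ ^ 2 := by
    rw [hA, hC, hnorm]
    nlinarith [hT0, hAy, hpγ, hp0, mul_nonneg (mul_nonneg hc0 hγ) (sq_nonneg ‖y‖), hδ, sq_nonneg α]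
  have hrw : μ₀ + c + c * γ / δ = (δ * (μ₀ + c) + c * γ) / δ := by
    field_simp
  rw [hrw, div_mul_eq_mul_div, le_div_iff₀ hδ]
  linarith [key]

end Compression

end SecondOrderTail

end Summit.Ventures.YMGap.FlowData
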